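import Literature.Topology.FourManifolds.DiscTheoremDiffeotopy
import Mathlib.AlgebraicTopology.FundamentalGroupoid.Basic
import HarnessLib

/-!
# Point pushing: diffeotopies with a prescribed track

Topic `Literature/Topology/FourManifolds` (fact seat
`provefact-Literature.Topology.FourManifolds.lauden-f709dd520c`, Laudenbach–Poénaru's Lemma 2,
`laudenbachPoenaru_exists_diffeoExtends_mapOfEq_eq`: the handle slides `H₃` of the printed proof
(Bull. SMF 100 (1972), p. 340) drag one foot of a `1`-handle once around a loop of the level; this
file provides the dragging).  Everything here is **proved**; no definitions of notions, no named
facts.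

Hirsch, *Differential Topology* (1976), Ch. 8 §1, Thm. 1.3 (isotopy extension with compact
support) applied to an isotopy of a *point* — a path `γ` — gives a compactly supported diffeotopy
whose time-`t` stage carries `γ 0` to `γ t` ("point pushing", Farb–Margalit, *A primer on mapping
class groups* (2012), §4.2).  We construct it flow-free, as a chain of the tree's translation pushes
transported along charts (`Literature.Topology.FourManifolds.translationPush`,
`AmbientIsotopy.alongChart`, `AmbientIsotopy.toDiffeotopy`; Hirsch, Ch. 8 §3, proof of Thm. 3.1),
keeping track of the **track** `t ↦ D_t p` of the pushed point:

* `Diffeotopy.trackPath D x` — the track of `x` on `[0, 1]` as a path from `x` to `D₁ x`;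
  `Diffeotopy.reparam'` — time reparametrisation along any smooth `l` with `D_{l 0} = id`;
* `exists_diffeotopy_push` — one translation push along a full-target chart: support in the
  chart image of `B̄(φ x, 2)`, stages `id` for `t ≤ 0` and constant for `t ≥ 1`, and the explicit
  track `D_t x = φ⁻¹(φ x + λ(t) v)`;
* `exists_diffeotopy_apply_eq_trackPath_homotopic` — **point pushing along a path**: for a path
  `γ` from `p` to `q` inside an open set `U` of a Hausdorff `n`-manifold there is a diffeotopy `D`
  of `M`, all of whose stages are the identity off a compact `K ⊆ U`, with `D₁ p = q` and whose
  track of `p` is homotopic to `γ` rel endpoints (Lebesgue partition of `γ` subordinate to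
  full-target charts in `U`; on each piece one push; chartwise straight-line homotopy);
* `exists_diffeotopy_pointPush` — **point pushing around a loop, with identity germ at the end**:
  if moreover `γ` is a loop at the centre `p = i 0` of an oriented disc `i : ℝⁿ → U`, the
  diffeotopy can be chosen with `D₁ ∘ i = i` on a small ball (so `D₁ = id` near `p`), its track
  still homotopic to `γ` (correct the end stage by the local disc theorem inside the ball
  `range i`, Hirsch, Ch. 8 §3, Thm. 3.1, whose extra track is null-homotopic there).

## References

* M. W. Hirsch, *Differential Topology*, GTM 33 (1976), Ch. 8 §1, Thms. 1.3–1.4 and Ch. 8 §3,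
  Thm. 3.1. [HirschDT1976]
* F. Laudenbach, V. Poénaru, *A note on 4-dimensional handlebodies*, Bull. Soc. Math. France 100
  (1972), 337–344, proof of Lemma 2 (p. 340). [LaudenbachPoenaruBSMF1972]
-/

open scoped Manifold ContDiff Topology unitInterval
open Set Function Filter Metric Module

noncomputable section

namespace Literature.Topology.FourManifolds

/-! ### Tracks and reparametrisations of diffeotopies -/

section Track

variable {EN HN : Type*} [NormedAddCommGroup EN] [NormedSpace ℝ EN] [TopologicalSpace HN]
  {J : ModelWithCorners ℝ EN HN} {N : Type*} [TopologicalSpace N] [ChartedSpace HN N]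

namespace Diffeotopy

/-- The track `t ↦ D_t x` of a point under a diffeotopy is continuous. [folklore] -/
theorem continuous_toFun_apply (D : Diffeotopy J N) (x : N) : Continuous fun t : ℝ => D.toFun t x :=
  D.contMDiff_uncurry_toFun.continuous.comp (continuous_id.prodMk continuous_const)

/-- **The track of a point** `x` under a diffeotopy on the time interval `[0, 1]`, as a path from
`x` to `D₁ x` (Hirsch 1976, Ch. 8 §1, p. 178: the track of an isotopy). [cite: HirschDT1976, Ch. 8 §1, p. 178] -/
def trackPath (D : Diffeotopy J N) (x : N) : Path x (D.toFun 1 x) where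
  toFun t := D.toFun t x
  continuous_toFun := (D.continuous_toFun_apply x).comp continuous_subtype_val
  source' := by simp
  target' := rfl

/-- Values of the track path (definitional). [folklore] -/
@[simp]
theorem trackPath_apply (D : Diffeotopy J N) (x : N) (t : I) : D.trackPath x t = D.toFun t x := rfl

variable (J) in
/-- **Time reparametrisation** of a diffeotopy along a smooth `l : ℝ → ℝ`, assuming only that the
stage at time `l 0` is the identity (e.g. `l 0 ≤ 0` for a diffeotopy which is stationary at
negative times). [folklore] -/
def reparam' (D : Diffeotopy J N) (l : ℝ → ℝ) (hl : ContDiff ℝ ∞ l) (h0 : D.toFun (l 0) = id) :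
    Diffeotopy J N :=
  Diffeotopy.mk' J (fun t => D.toFun (l t)) (fun t => D.invFun (l t))
    (D.contMDiff_uncurry_toFun.comp (f := fun p : ℝ × N => (l p.1, p.2))
      ((hl.contMDiff.comp contMDiff_fst).prodMk contMDiff_snd))
    (D.contMDiff_uncurry_invFun.comp (f := fun p : ℝ × N => (l p.1, p.2))
      ((hl.contMDiff.comp contMDiff_fst).prodMk contMDiff_snd))
    (fun t x => D.invFun_toFun (l t) x) (fun t y => D.toFun_invFun (l t) y) h0

/-- Stages of the reparametrised diffeotopy (definitional). [folklore] -/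
@[simp]
theorem reparam'_toFun (D : Diffeotopy J N) (l : ℝ → ℝ) (hl : ContDiff ℝ ∞ l)
    (h0 : D.toFun (l 0) = id) (t : ℝ) : (D.reparam' J l hl h0).toFun t = D.toFun (l t) := rfl

/-- A stage which is the identity off a set maps that set into itself. [folklore] -/
theorem toFun_mem_of_forall_eq_self (D : Diffeotopy J N) {K : Set N} {t : ℝ}
    (hK : ∀ x, x ∉ K → D.toFun t x = x) {x : N} (hx : x ∈ K) : D.toFun t x ∈ K := by
  by_contra h
  have h1 : D.toFun t (D.toFun t x) = D.toFun t x := hK _ h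
  have h2 : D.toFun t x = x := (D.stage t).injective h1
  exact h (by rw [h2]; exact hx)

end Diffeotopy

end Track

/-! ### One translation push along a chart, with its track -/

section Push

variable {n : ℕ}

/-- Local notation: `𝔼 n` is the model Euclidean space `EuclideanSpace ℝ (Fin n)`. -/
local notation "𝔼 " n:arg => EuclideanSpace ℝ (Fin n)

variable {M : Type*} [TopologicalSpace M] [T2Space M] [ChartedSpace (𝔼 n) M]
  [IsManifold (𝓡 n) ∞ M]

omit [T2Space M] [ChartedSpace (𝔼 n) M] [IsManifold (𝓡 n) ∞ M] in
/-- The transport of the identity along a chart is the identity. [folklore] -/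
theorem chartTransport_eq_id {φ : OpenPartialHomeomorph M (𝔼 n)} {s : 𝔼 n → 𝔼 n}
    (hs : ∀ z, s z = z) : chartTransport φ s = id := by
  funext x
  by_cases hx : x ∈ φ.source
  · rw [chartTransport_of_mem s hx, hs, φ.left_inv hx]; rfl
  · exact chartTransport_of_not_mem s hx

/-- The translation push at a non-positive time is the identity. [folklore] -/
theorem translationPushFun_of_nonpos (v : 𝔼 n) {t : ℝ} (ht : t ≤ 0) (z : 𝔼 n) :
    translationPushFun v t z = z := by
  simp [translationPushFun, Real.smoothTransition.zero_of_nonpos ht]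

/-- The translation push is stationary from time `1` on. [folklore] -/
theorem translationPushFun_of_one_le (v : 𝔼 n) {t : ℝ} (ht : 1 ≤ t) (z : 𝔼 n) :
    translationPushFun v t z = translationPushFun v 1 z := by
  simp [translationPushFun, Real.smoothTransition.one_of_one_le ht, Real.smoothTransition.one]

/-- The track of the origin under the translation push: `P^v_t (0) = λ(t) v`. [folklore] -/
theorem translationPushFun_apply_zero (v : 𝔼 n) (t : ℝ) :
    translationPushFun v t 0 = Real.smoothTransition t • v := by
  simp [translationPushFun, pushBump_apply_zero]

/-- **One translation push along a full-target chart, with its track.**  For a smooth chart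
`φ : M ⊇ U → ℝⁿ` with smooth inverse and full target, `x ∈ U` and `‖v‖ ≤ δ(ℝⁿ)` (`pushRadius`),
there is a diffeotopy of `M` whose stages are the identity off `φ⁻¹(B̄(φ x, 2))`, equal to the
identity for `t ≤ 0`, stationary for `t ≥ 1`, and which moves `x` along the chart segment
`D_t x = φ⁻¹(φ x + λ(t) v)` (`λ = Real.smoothTransition`), so that `D₁ x = φ⁻¹(φ x + v)`: the
translation push of the model recentred at `φ x` and transported along `φ` (Hirsch 1976, Ch. 8
§3, proof of Thm. 3.1, first step, with Ch. 8 §1, Thms. 1.3–1.4 for the transport).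
[cite: HirschDT1976, Ch. 8 §3, Thm. 3.1 (k = 0)] -/
theorem exists_diffeotopy_push {φ : OpenPartialHomeomorph M (𝔼 n)}
    (hφ : ContMDiffOn (𝓡 n) (𝓡 n) ∞ φ φ.source) (hφ' : ContMDiff (𝓡 n) (𝓡 n) ∞ φ.symm)
    (htarget : φ.target = univ) {x : M} (hx : x ∈ φ.source) {v : 𝔼 n}
    (hv : ‖v‖ ≤ pushRadius (𝔼 n)) :
    ∃ D : Diffeotopy (𝓡 n) M,
      (∀ t z, z ∉ φ.symm '' closedBall (φ x) 2 → D.toFun t z = z) ∧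
      (∀ t : ℝ, t ≤ 0 → D.toFun t = id) ∧
      (∀ t : ℝ, 1 ≤ t → D.toFun t = D.toFun 1) ∧
      ∀ t, D.toFun t x = φ.symm (φ x + Real.smoothTransition t • v) := by
  -- the chart recentred at `φ x`
  set a : 𝔼 n := φ x with ha
  set ψ : OpenPartialHomeomorph M (𝔼 n) :=
    φ.trans (Homeomorph.addRight (-a)).toOpenPartialHomeomorph with hψ
  have hψsrc : ψ.source = φ.source := by
    simp [hψ]
  have hψt : ψ.target = univ := by
    rw [hψ, OpenPartialHomeomorph.trans_target, Homeomorph.toOpenPartialHomeomorph_target, htarget,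
      preimage_univ, inter_univ]
  have hψapp : ∀ z, ψ z = φ z - a := fun z => by
    simp [hψ, sub_eq_add_neg]
  have hψsymm : ∀ y, ψ.symm y = φ.symm (y + a) := fun y => by
    simp [hψ, OpenPartialHomeomorph.trans_symm_eq_symm_trans_symm, Homeomorph.addRight_symm]
  have hψc : ContMDiffOn (𝓡 n) (𝓡 n) ∞ ψ ψ.source := by
    rw [hψsrc]
    have h : ContMDiffOn (𝓡 n) (𝓡 n) ∞ (fun z => φ z - a) φ.source := hφ.sub contMDiffOn_const
    exact h.congr fun z _ => hψapp z
  have hψc' : ContMDiff (𝓡 n) (𝓡 n) ∞ ψ.symm := by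
    have h : ContMDiff (𝓡 n) (𝓡 n) ∞ (fun y : 𝔼 n => φ.symm (y + a)) :=
      hφ'.comp (contMDiff_id.add contMDiff_const)
    exact h.congr fun y => hψsymm y
  -- the transported push
  set F : AmbientIsotopy (𝓡 n) M := (translationPush hv).alongChart hψc hψc' hψt (R := 2)
    (fun t y hy => translationPushFun_eq_self v t hy) with hF
  have hFt : ∀ t, F.toFun t = chartTransport ψ (translationPushFun v t) := fun t => rfl
  refine ⟨F.toDiffeotopy, fun t z hz => ?_, fun t ht => ?_, fun t ht => ?_, fun t => ?_⟩
  · rw [AmbientIsotopy.toDiffeotopy_toFun, hFt]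
    refine chartTransport_eq_self (fun y hy => translationPushFun_eq_self v t hy) fun hz' => hz ?_
    obtain ⟨y, hy, rfl⟩ := hz'
    refine ⟨y + a, ?_, (hψsymm y).symm⟩
    simpa [mem_closedBall, dist_eq_norm] using hy
  · rw [AmbientIsotopy.toDiffeotopy_toFun, hFt]
    exact chartTransport_eq_id fun z => translationPushFun_of_nonpos v ht z
  · rw [AmbientIsotopy.toDiffeotopy_toFun, hFt, hFt]
    congr 1
    funext z
    exact translationPushFun_of_one_le v ht z
  · rw [AmbientIsotopy.toDiffeotopy_toFun, hFt, chartTransport_of_mem _ (hψsrc ▸ hx), hψapp, ← ha,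
      sub_self, translationPushFun_apply_zero, hψsymm, add_comm]

end Push

/-! ### Point pushing along a path -/

section Along

variable {n : ℕ}

/-- Local notation: `𝔼 n` is the model Euclidean space `EuclideanSpace ℝ (Fin n)`. -/
local notation "𝔼 " n:arg => EuclideanSpace ℝ (Fin n)

variable {M : Type*} [TopologicalSpace M] [T2Space M] [ChartedSpace (𝔼 n) M]
  [IsManifold (𝓡 n) ∞ M]

/-- **Point pushing along a path** (isotopy extension for a point, with the track recorded).
For a path `γ` from `p` to `q` lying in an open set `U` of a Hausdorff smooth `n`-manifold `M`
there is a diffeotopy `D` of `M` all of whose stages are the identity off a compact set `K ⊆ U`,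
with `D₁ p = q`, stationary outside the time interval `[0, 1]`, and such that the track
`t ↦ D_t p` (`t ∈ [0, 1]`) is homotopic to `γ` rel endpoints.  Proof: a Lebesgue partition `0 = τ₀ < ⋯ < τ_N = 1` of `γ` subordinate to full-target
charts in `U`, consecutive nodes `ρ`-close in the chart; on `[τₘ, τₘ₊₁]` the translation push of
the `m`-th chart from `γ τₘ` to `γ τₘ₊₁`, run at speed `N` (`exists_diffeotopy_push`); the track and
`γ` lie piecewise in a common chart, where the straight-line homotopy joins them (Hirsch 1976,
Ch. 8 §1, Thm. 1.3 for the compact submanifold `{p}`; Ch. 8 §3, proof of Thm. 3.1, `k = 0`).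
[cite: HirschDT1976, Ch. 8 §1, Thm. 1.3; Ch. 8 §3, Thm. 3.1 (k = 0)] -/
theorem exists_diffeotopy_apply_eq_trackPath_homotopic {p q : M} (γ : Path p q) {U : Set M}
    (hU : IsOpen U) (hγU : range γ ⊆ U) :
    ∃ (D : Diffeotopy (𝓡 n) M) (K : Set M), IsCompact K ∧ K ⊆ U ∧
      (∀ t z, z ∉ K → D.toFun t z = z) ∧
      (∀ t : ℝ, t ≤ 0 → D.toFun t = id) ∧ (∀ t : ℝ, 1 ≤ t → D.toFun t = D.toFun 1) ∧
      ∃ h1 : D.toFun 1 p = q, ((D.trackPath p).cast rfl h1.symm).Homotopic γ := by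
  -- Step 1: full-target charts in `U` along `γ`
  have hch : ∀ s : I, ∃ e ∈ IsManifold.maximalAtlas (𝓡 n) ∞ M, γ s ∈ e.source ∧ e.source ⊆ U ∧
      e.target = univ ∧ e (γ s) = 0 := fun s =>
    exists_mem_maximalAtlas_target_eq_univ_source_subset_apply_eq_zero (n := n) (γ s)
      (hU.mem_nhds (hγU ⟨s, rfl⟩))
  choose e he hγe heU het he0 using hch
  -- Step 2: a Lebesgue number for the cover of `[0, 1]` by the small chart balls
  set ρ : ℝ := pushRadius (𝔼 n) / 2 with hρ_def
  have hρ : 0 < ρ := half_pos (pushRadius_pos (𝔼 n))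
  let c : I → Set I := fun s => γ ⁻¹' ((e s).source ∩ (e s) ⁻¹' ball 0 ρ)
  have hco : ∀ s, IsOpen (c s) := fun s =>
    ((e s).isOpen_inter_preimage isOpen_ball).preimage γ.continuous
  have hcov : (univ : Set I) ⊆ ⋃ s, c s := fun s _ =>
    mem_iUnion.2 ⟨s, hγe s, by rw [mem_preimage, he0 s]; exact mem_ball_self hρ⟩
  obtain ⟨δ, hδ, hleb⟩ := lebesgue_number_lemma_of_metric isCompact_univ hco hcov
  choose sel hsel using fun x : I => hleb x (mem_univ x)
  -- Step 3: the partition `τ m = min (m / N) 1`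
  obtain ⟨N₀, hN₀⟩ := exists_nat_one_div_lt hδ
  set N : ℕ := N₀ + 1 with hN_def
  have hNpos : (0 : ℝ) < N := by positivity
  have hNne : (N : ℝ) ≠ 0 := hNpos.ne'
  have hN1 : 1 ≤ N := by omega
  have hNδ : 1 / (N : ℝ) < δ := by
    have : (N : ℝ) = N₀ + 1 := by simp [hN_def]
    rwa [this]
  let τ : ℕ → ℝ := fun m => min ((m : ℝ) / N) 1
  have hτ0 : ∀ m, 0 ≤ τ m := fun m => le_min (by positivity) zero_le_one
  have hτ1 : ∀ m, τ m ≤ 1 := fun m => min_le_right _ _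
  have hτmono : Monotone τ := fun a b hab =>
    min_le_min_right _ (div_le_div_of_nonneg_right (by exact_mod_cast hab) hNpos.le)
  have hτN : ∀ m, m ≤ N → (N : ℝ) * τ m = m := fun m hm => by
    have h1 : (m : ℝ) / N ≤ 1 := by
      rw [div_le_one hNpos]; exact_mod_cast hm
    show (N : ℝ) * min ((m : ℝ) / N) 1 = m
    rw [min_eq_left h1]; field_simp
  have hτle : ∀ m, (N : ℝ) * τ m ≤ m := fun m => by
    show (N : ℝ) * min ((m : ℝ) / N) 1 ≤ m
    calc (N : ℝ) * min ((m : ℝ) / N) 1 ≤ N * ((m : ℝ) / N) :=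
          mul_le_mul_of_nonneg_left (min_le_left _ _) hNpos.le
      _ = m := by field_simp
  have hτeq1 : ∀ m, N ≤ m → τ m = 1 := fun m hm => by
    show min ((m : ℝ) / N) 1 = 1
    rw [min_eq_right]
    rw [le_div_iff₀ hNpos, one_mul]; exact_mod_cast hm
  have hτstep : ∀ m, τ (m + 1) ≤ τ m + 1 / N := fun m => by
    show min (((m + 1 : ℕ) : ℝ) / N) 1 ≤ min ((m : ℝ) / N) 1 + 1 / N
    calc min (((m + 1 : ℕ) : ℝ) / N) 1 ≤ min ((m : ℝ) / N + 1 / N) (1 + 1 / N) := by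
          refine min_le_min (le_of_eq ?_) (by simp [hNpos.le])
          push_cast; ring
      _ = min ((m : ℝ) / N) 1 + 1 / N := min_add_add_right _ _ _
  let node : ℕ → I := fun m => ⟨τ m, hτ0 m, hτ1 m⟩
  have hnode : ∀ m, (node m : ℝ) = τ m := fun m => rfl
  have hnode0 : node 0 = 0 := Subtype.ext (by simp [hnode, τ])
  have hnodeN : ∀ m, N ≤ m → node m = 1 := fun m hm => Subtype.ext (by rw [hnode, hτeq1 m hm]; rfl)
  -- the charts of the pieces
  let E : ℕ → OpenPartialHomeomorph M (𝔼 n) := fun m => e (sel (node m))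
  have hEc : ∀ m, ContMDiffOn (𝓡 n) (𝓡 n) ∞ (E m) (E m).source := fun m =>
    contMDiffOn_of_mem_maximalAtlas (he _)
  have hEt : ∀ m, (E m).target = univ := fun m => het _
  have hEc' : ∀ m, ContMDiff (𝓡 n) (𝓡 n) ∞ (E m).symm := fun m => by
    have h := contMDiffOn_symm_of_mem_maximalAtlas (he (sel (node m)))
    rwa [hEt m, contMDiffOn_univ] at h
  have hEU : ∀ m, (E m).source ⊆ U := fun m => heU _
  have hEsymm_mem : ∀ m y, (E m).symm y ∈ (E m).source := fun m y =>
    (E m).map_target (by rw [hEt m]; trivial)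
  -- points of the `m`-th piece lie in the small ball of the `m`-th chart
  have hpiece : ∀ (m : ℕ) (t : I), τ m ≤ t → (t : ℝ) ≤ τ (m + 1) →
      γ t ∈ (E m).source ∧ ‖E m (γ t)‖ < ρ := by
    intro m t h1 h2
    have hdist : dist t (node m) < δ := by
      rw [Subtype.dist_eq, Real.dist_eq, hnode, abs_of_nonneg (by linarith)]
      have := hτstep m
      linarith
    have ht : t ∈ c (sel (node m)) := hsel (node m) (mem_ball.2 hdist)
    simp only [c, mem_preimage, mem_inter_iff, mem_ball, dist_zero_right] at ht
    exact ht
  have hx : ∀ m, γ (node m) ∈ (E m).source := fun m =>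
    (hpiece m (node m) le_rfl (hτmono (Nat.le_succ m))).1
  have hx' : ∀ m, γ (node (m + 1)) ∈ (E m).source := fun m =>
    (hpiece m (node (m + 1)) (hτmono (Nat.le_succ m)) le_rfl).1
  -- Step 4: the pushes
  let v : ℕ → 𝔼 n := fun m => E m (γ (node (m + 1))) - E m (γ (node m))
  have hv : ∀ m, ‖v m‖ ≤ pushRadius (𝔼 n) := fun m => by
    have h1 := (hpiece m (node (m + 1)) (hτmono (Nat.le_succ m)) le_rfl).2
    have h2 := (hpiece m (node m) le_rfl (hτmono (Nat.le_succ m))).2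
    calc ‖v m‖ ≤ ‖E m (γ (node (m + 1)))‖ + ‖E m (γ (node m))‖ := norm_sub_le _ _
      _ ≤ pushRadius (𝔼 n) := by rw [hρ_def] at h1 h2; linarith
  have hpush : ∀ m : ℕ, ∃ D : Diffeotopy (𝓡 n) M,
      (∀ t z, z ∉ (E m).symm '' closedBall (E m (γ (node m))) 2 → D.toFun t z = z) ∧
      (∀ t : ℝ, t ≤ 0 → D.toFun t = id) ∧
      (∀ t : ℝ, 1 ≤ t → D.toFun t = D.toFun 1) ∧
      ∀ t, D.toFun t (γ (node m)) =
        (E m).symm (E m (γ (node m)) + Real.smoothTransition t • v m) := fun m =>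
    exists_diffeotopy_push (hEc m) (hEc' m) (hEt m) (hx m) (hv m)
  choose P hPsupp hP0 hP1 hPtrack using hpush
  have hl : ∀ m : ℕ, ContDiff ℝ ∞ (fun t : ℝ => (N : ℝ) * t - m) := fun m =>
    (contDiff_const.mul contDiff_id).sub contDiff_const
  have hl0 : ∀ m : ℕ, (P m).toFun ((N : ℝ) * 0 - m) = id := fun m =>
    hP0 m _ (by simp)
  let Q : ℕ → Diffeotopy (𝓡 n) M := fun m =>
    (P m).reparam' (𝓡 n) (fun t => (N : ℝ) * t - m) (hl m) (hl0 m)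
  have hQ : ∀ m t, (Q m).toFun t = (P m).toFun ((N : ℝ) * t - m) := fun m t => rfl
  -- Step 5: the chain `D (m + 1) = D m` followed by `Q m`
  let D : ℕ → Diffeotopy (𝓡 n) M := fun m =>
    @Nat.rec (fun _ => Diffeotopy (𝓡 n) M) (Diffeotopy.refl (𝓡 n) M) (fun m Dm => Dm.trans (Q m)) m
  have hD0 : D 0 = Diffeotopy.refl (𝓡 n) M := rfl
  have hDsucc : ∀ m t, (D (m + 1)).toFun t = (Q m).toFun t ∘ (D m).toFun t := fun m t =>
    Diffeotopy.trans_toFun _ _ t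
  -- the support
  let K : Set M := ⋃ m ∈ Finset.range N, (E m).symm '' closedBall (E m (γ (node m))) 2
  have hKc : IsCompact K := (Finset.range N).isCompact_biUnion fun m _ =>
    (isCompact_closedBall _ _).image (hEc' m).continuous
  have hKU : K ⊆ U := by
    intro z hz
    simp only [K, mem_iUnion, Finset.mem_range] at hz
    obtain ⟨m, -, y, -, rfl⟩ := hz
    exact hEU m (hEsymm_mem m y)
  -- the invariants of the chain
  have hclaim : ∀ m : ℕ, m ≤ N →
      (∀ t z, z ∉ K → (D m).toFun t z = z) ∧
      (∀ l, l < m → ∀ t : ℝ, τ l ≤ t → t ≤ τ (l + 1) →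
        (D m).toFun t p = (E l).symm (E l (γ (node l)) + Real.smoothTransition ((N : ℝ) * t - l) • v l)) ∧
      (∀ t : ℝ, τ m ≤ t → (D m).toFun t p = γ (node m)) := by
    intro m
    induction m with
    | zero =>
      intro _
      refine ⟨fun t z _ => by simp [hD0], fun l hl => absurd hl (Nat.not_lt_zero l), fun t _ => ?_⟩
      simp [hD0, hnode0]
    | succ m ih =>
      intro hm
      obtain ⟨ihS, ihV1, ihV2⟩ := ih (Nat.le_of_succ_le hm)
      have hmN : m < N := hm
      refine ⟨fun t z hz => ?_, fun l hl t ht1 ht2 => ?_, fun t ht => ?_⟩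
      · rw [hDsucc, comp_apply, ihS t z hz, hQ]
        refine hPsupp m _ z fun hz' => hz ?_
        simp only [K, mem_iUnion, Finset.mem_range]
        exact ⟨m, hmN, hz'⟩
      · rw [hDsucc, comp_apply, hQ]
        rcases Nat.lt_succ_iff_lt_or_eq.1 hl with hl' | rfl
        · -- an earlier piece: the new push has not started yet
          rw [ihV1 l hl' t ht1 ht2]
          have hle : (N : ℝ) * t - m ≤ 0 := by
            have h1 : τ (l + 1) ≤ τ m := hτmono (Nat.succ_le_of_lt hl')
            have h2 := hτle m
            nlinarith
          rw [hP0 m _ hle]; rfl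
        · -- the current piece
          rw [ihV2 t ht1, hPtrack]
      · rw [hDsucc, comp_apply, hQ, ihV2 t ((hτmono (Nat.le_succ m)).trans ht)]
        have hge : 1 ≤ (N : ℝ) * t - m := by
          have h1 : (N : ℝ) * τ (m + 1) = (m + 1 : ℕ) := hτN (m + 1) hm
          push_cast at h1
          nlinarith
        rw [hP1 m _ hge, hPtrack, Real.smoothTransition.one, one_smul]
        show (E m).symm (E m (γ (node m)) + (E m (γ (node (m + 1))) - E m (γ (node m)))) = _
        rw [add_sub_cancel, (E m).left_inv (hx' m)]
  obtain ⟨hS, hV1, hV2⟩ := hclaim N le_rfl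
  -- the chain is the identity at negative times and stationary from time `1` on
  have hclamp0 : ∀ (m : ℕ) (t : ℝ), t ≤ 0 → (D m).toFun t = id := by
    intro m
    induction m with
    | zero => intro t _; simp [hD0]
    | succ m ih =>
      intro t ht
      rw [hDsucc, ih t ht, hQ, hP0 m _ (by nlinarith [hNpos])]
      rfl
  have hclamp1 : ∀ m : ℕ, m ≤ N → ∀ t : ℝ, 1 ≤ t → (D m).toFun t = (D m).toFun 1 := by
    intro m
    induction m with
    | zero => intro _ t _; simp [hD0]
    | succ m ih =>
      intro hm t ht
      have hmN : (m : ℝ) + 1 ≤ N := by exact_mod_cast hm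
      rw [hDsucc, hDsucc, ih (Nat.le_of_succ_le hm) t ht, hQ, hQ, hP1 m _ (by nlinarith),
        hP1 m ((N : ℝ) * 1 - m) (by linarith)]
  -- Step 6: the end point and the track at the nodes
  have h1 : (D N).toFun 1 p = q := by
    rw [hV2 1 (by rw [hτeq1 N le_rfl]), hnodeN N le_rfl, γ.target]
  have hTnode : ∀ j, (D N).toFun (τ j) p = γ (node j) := by
    intro j
    rcases lt_or_ge j N with hj | hj
    · rw [hV1 j hj (τ j) le_rfl (hτmono (Nat.le_succ j)), hτN j hj.le, sub_self,
        Real.smoothTransition.zero, zero_smul, add_zero, (E j).left_inv (hx j)]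
    · rw [hτeq1 j hj, ← hτeq1 N le_rfl, hV2 (τ N) le_rfl, hnodeN N le_rfl, hnodeN j hj]
  have hTmem : ∀ (m : ℕ), m < N → ∀ t : I, τ m ≤ t → (t : ℝ) ≤ τ (m + 1) →
      (D N).toFun t p ∈ (E m).source := by
    intro m hm t ht1 ht2
    rw [hV1 m hm t ht1 ht2]
    exact hEsymm_mem m _
  -- the index of the piece containing `t`
  let idx : I → ℕ := fun t => min ⌊(N : ℝ) * t⌋₊ (N - 1)
  have hidx : ∀ t : I, idx t < N ∧ τ (idx t) ≤ t ∧ (t : ℝ) ≤ τ (idx t + 1) := by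
    intro t
    have ht0 : (0 : ℝ) ≤ t := t.2.1
    have ht1 : (t : ℝ) ≤ 1 := t.2.2
    have hk1 : (⌊(N : ℝ) * t⌋₊ : ℝ) ≤ N * t := Nat.floor_le (by positivity)
    have hk2 : (N : ℝ) * t < ⌊(N : ℝ) * t⌋₊ + 1 := Nat.lt_floor_add_one _
    rcases le_or_gt ⌊(N : ℝ) * t⌋₊ (N - 1) with hk | hk
    · have hidxt : idx t = ⌊(N : ℝ) * t⌋₊ := min_eq_left hk
      rw [hidxt]
      refine ⟨by omega, ?_, ?_⟩
      · show min ((⌊(N : ℝ) * t⌋₊ : ℝ) / N) 1 ≤ t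
        calc min ((⌊(N : ℝ) * t⌋₊ : ℝ) / N) 1 ≤ (⌊(N : ℝ) * t⌋₊ : ℝ) / N := min_le_left _ _
          _ ≤ t := by rw [div_le_iff₀ hNpos]; linarith
      · show (t : ℝ) ≤ min (((⌊(N : ℝ) * t⌋₊ + 1 : ℕ) : ℝ) / N) 1
        refine le_min ?_ ht1
        rw [le_div_iff₀ hNpos]; push_cast; linarith
    · have hidxt : idx t = N - 1 := min_eq_right hk.le
      rw [hidxt]
      have hNt : (N : ℝ) ≤ N * t := by
        have : ((N - 1 : ℕ) : ℝ) + 1 ≤ ⌊(N : ℝ) * t⌋₊ := by exact_mod_cast hk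
        have h3 : ((N - 1 : ℕ) : ℝ) + 1 = N := by
          rw [Nat.cast_sub hN1]; push_cast; ring
        linarith
      have ht1' : (t : ℝ) = 1 := le_antisymm ht1 (by nlinarith)
      refine ⟨by omega, ?_, ?_⟩
      · exact (hτ1 _).trans ht1'.ge
      · rw [Nat.sub_add_cancel hN1, hτeq1 N le_rfl]; exact ht1
  -- Step 7: the chartwise straight-line homotopy
  let T : I → M := fun t => (D N).toFun t p
  have hTc : Continuous T := ((D N).continuous_toFun_apply p).comp continuous_subtype_val
  let F : ℕ → I × I → M := fun m x =>
    (E m).symm ((1 - (x.1 : ℝ)) • E m (T x.2) + (x.1 : ℝ) • E m (γ x.2))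
  let H : I × I → M := fun x => F (idx x.2) x
  -- on the `m`-th piece `H` is `F m`
  have hnode_of_eq : ∀ (t : I) (j : ℕ), (t : ℝ) = τ j → T t = γ t ∧ γ t = γ (node j) := by
    intro t j htj
    have ht : t = node j := Subtype.ext htj
    subst ht
    exact ⟨hTnode j, rfl⟩
  have hHF : ∀ m, m < N → ∀ x : I × I, τ m ≤ x.2 → (x.2 : ℝ) ≤ τ (m + 1) → H x = F m x := by
    intro m hm x h1 h2
    obtain ⟨hm', h1', h2'⟩ := hidx x.2
    show F (idx x.2) x = F m x
    rcases eq_or_ne (idx x.2) m with heq | hne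
    · rw [heq]
    · -- `x.2` is a common node of the two pieces, where `T = γ`
      have hcommon : ∃ j, (x.2 : ℝ) = τ j := by
        rcases lt_or_gt_of_ne hne with hlt | hgt
        · exact ⟨m, le_antisymm (h2'.trans (hτmono (Nat.succ_le_of_lt hlt))) h1⟩
        · exact ⟨idx x.2, le_antisymm (h2.trans (hτmono (Nat.succ_le_of_lt hgt))) h1'⟩
      obtain ⟨j, hj⟩ := hcommon
      obtain ⟨hT, -⟩ := hnode_of_eq x.2 j hj
      have hmem1 : γ x.2 ∈ (E (idx x.2)).source := (hpiece _ x.2 h1' h2').1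
      have hmem2 : γ x.2 ∈ (E m).source := (hpiece m x.2 h1 h2).1
      simp only [F, hT, ← add_smul, sub_add_cancel, one_smul]
      rw [(E (idx x.2)).left_inv hmem1, (E m).left_inv hmem2]
  -- continuity
  have hFc : ∀ m, m < N → ContinuousOn (F m) {x : I × I | τ m ≤ x.2 ∧ (x.2 : ℝ) ≤ τ (m + 1)} := by
    intro m hm
    have hs : ContinuousOn (fun x : I × I => (x.1 : ℝ)) univ :=
      (continuous_subtype_val.comp continuous_fst).continuousOn
    have hT' : ContinuousOn (fun x : I × I => E m (T x.2)) {x | τ m ≤ x.2 ∧ (x.2 : ℝ) ≤ τ (m + 1)} :=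
      (E m).continuousOn.comp (hTc.comp continuous_snd).continuousOn fun x hx => hTmem m hm x.2 hx.1 hx.2
    have hγ' : ContinuousOn (fun x : I × I => E m (γ x.2)) {x | τ m ≤ x.2 ∧ (x.2 : ℝ) ≤ τ (m + 1)} :=
      (E m).continuousOn.comp (γ.continuous.comp continuous_snd).continuousOn
        fun x hx => (hpiece m x.2 hx.1 hx.2).1
    refine (hEc' m).continuous.comp_continuousOn ?_
    exact (((continuousOn_const.sub (hs.mono (subset_univ _))).smul hT').add
      ((hs.mono (subset_univ _)).smul hγ'))
  have hHc : Continuous H := by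
    refine LocallyFinite.continuous (f := fun m : Fin N => {x : I × I | τ m ≤ x.2 ∧ (x.2 : ℝ) ≤ τ (m + 1)})
      (locallyFinite_of_finite _) ?_ (fun m => ?_) (fun m => ?_)
    · refine eq_univ_of_forall fun x => mem_iUnion.2 ?_
      obtain ⟨h0, h1', h2'⟩ := hidx x.2
      exact ⟨⟨idx x.2, h0⟩, h1', h2'⟩
    · exact (isClosed_le continuous_const (continuous_subtype_val.comp continuous_snd)).inter
        (isClosed_le (continuous_subtype_val.comp continuous_snd) continuous_const)
    · exact (hFc m m.2).congr fun x hx => hHF m m.2 x hx.1 hx.2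
  -- the values of `H` on the boundary of the square
  have hH0 : ∀ t : I, H (0, t) = T t := by
    intro t
    obtain ⟨h0, h1', h2'⟩ := hidx t
    show F (idx t) (0, t) = T t
    simp only [F, Icc.coe_zero, sub_zero, one_smul, zero_smul, add_zero]
    exact (E (idx t)).left_inv (hTmem _ h0 t h1' h2')
  have hH1 : ∀ t : I, H (1, t) = γ t := by
    intro t
    obtain ⟨h0, h1', h2'⟩ := hidx t
    show F (idx t) (1, t) = γ t
    simp only [F, Icc.coe_one, sub_self, zero_smul, one_smul, zero_add]
    exact (E (idx t)).left_inv (hpiece _ t h1' h2').1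
  have hHends : ∀ (s t : I), T t = γ t → H (s, t) = γ t := by
    intro s t hTt
    obtain ⟨h0, h1', h2'⟩ := hidx t
    show F (idx t) (s, t) = γ t
    simp only [F, hTt, ← add_smul, sub_add_cancel, one_smul]
    exact (E (idx t)).left_inv (hpiece _ t h1' h2').1
  have hT0 : T 0 = γ 0 := by
    have h := hTnode 0
    have h0 : τ 0 = 0 := by simp [τ]
    rw [hnode0, h0] at h
    show (D N).toFun ((0 : I) : ℝ) p = γ 0
    rw [Set.Icc.coe_zero]; exact h
  have hT1 : T 1 = γ 1 := by
    have h := hTnode N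
    rw [hnodeN N le_rfl, hτeq1 N le_rfl] at h
    exact h
  refine ⟨D N, K, hKc, hKU, hS, hclamp0 N, hclamp1 N le_rfl, h1, ⟨?_⟩⟩
  exact
    { toFun := H
      continuous_toFun := hHc
      map_zero_left := fun t => by rw [hH0]; rfl
      map_one_left := fun t => hH1 t
      prop' := fun s t ht => by
        simp only [mem_insert_iff, mem_singleton_iff] at ht
        show H (s, t) = _
        rcases ht with rfl | rfl
        · rw [hHends s 0 hT0]; simp
        · rw [hHends s 1 hT1]; simp }

end Along

/-! ### Point pushing around a loop, with identity germ at the end -/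

section Loop

variable {n : ℕ}

/-- Local notation: `𝔼 n` is the model Euclidean space `EuclideanSpace ℝ (Fin n)`. -/
local notation "𝔼 " n:arg => EuclideanSpace ℝ (Fin n)

variable {M : Type*} [TopologicalSpace M] [T2Space M] [ChartedSpace (𝔼 n) M]
  [IsManifold (𝓡 n) ∞ M]

omit [T2Space M] [IsManifold (𝓡 n) ∞ M] in
/-- **Loops inside a disc are null-homotopic**: for a disc `i : ℝⁿ → M` (a smooth embedding of
`ℝⁿ`), a loop at `i 0` whose image lies in `range i` is homotopic rel endpoints to the constant
loop (contract in the chart `i⁻¹`). [folklore] -/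
theorem Path.Homotopic.refl_of_range_subset_range_disc {i : 𝔼 n → M}
    (hi : Manifold.IsSmoothEmbedding 𝓘(ℝ, 𝔼 n) (𝓡 n) ∞ i) (l : Path (i 0) (i 0))
    (hl : range l ⊆ range i) : l.Homotopic (Path.refl (i 0)) := by
  obtain ⟨Φ, hΦt, hΦs, hΦsrc, -⟩ := exists_chart_of_isSmoothEmbedding hi
  have hmem : ∀ t, l t ∈ Φ.source := fun t => by rw [hΦsrc]; exact hl ⟨t, rfl⟩
  have hΦ0 : Φ (i 0) = 0 := by
    rw [← hΦs]; exact Φ.right_inv (by rw [hΦt]; trivial)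
  have hG : Continuous fun x : I × I => i ((1 - (x.1 : ℝ)) • Φ (l x.2)) := by
    refine hi.contMDiff.continuous.comp ?_
    refine ((continuous_const.sub (continuous_subtype_val.comp continuous_fst)).smul ?_)
    exact Φ.continuousOn.comp_continuous (l.continuous.comp continuous_snd) fun x => hmem x.2
  refine ⟨{ toFun := fun x => i ((1 - (x.1 : ℝ)) • Φ (l x.2))
            continuous_toFun := hG
            map_zero_left := fun t => ?_
            map_one_left := fun t => ?_
            prop' := fun s t ht => ?_ }⟩
  · show i ((1 - ((0 : I) : ℝ)) • Φ (l t)) = l t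
    have e : ∀ z, i z = Φ.symm z := fun z => congrFun hΦs.symm z
    rw [Set.Icc.coe_zero, sub_zero, one_smul, e (Φ (l t)), Φ.left_inv (hmem t)]
  · show i ((1 - ((1 : I) : ℝ)) • Φ (l t)) = i 0
    rw [Set.Icc.coe_one, sub_self, zero_smul]
  · show i ((1 - (s : ℝ)) • Φ (l t)) = l t
    simp only [mem_insert_iff, mem_singleton_iff] at ht
    rcases ht with rfl | rfl
    · rw [l.source, hΦ0, smul_zero]
    · rw [l.target, hΦ0, smul_zero]

/-- **Local disc theorem for two discs with the same centre, supported in the second disc.**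
If `i, i' : ℝⁿ → M` are discs preserving the orientations `(o₀, oM)` with `i 0 = i' 0`, there is
a diffeomorphism `f` of `M`, compactly diffeotopic to the identity **inside `range i'`**, with
`f (i y) = i' y` for `‖y‖ ≤ ρ` (steps 2–7 of the proof of
`exists_isCompactlyDiffeotopicToIdIn_apply_disc_eq_local`: in the chart `Φ' = (i')⁻¹` the map
`Φ' ∘ i` has differential in `GL⁺` at `0`, is straightened by a compactly diffeotopic `s` and
then agrees near `0` with a compactly diffeotopic `G`; transport `s ∘ G` back along `Φ'`).
[cite: HirschDT1976, Ch. 8 §3, Thm. 3.1] -/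
theorem exists_isCompactlyDiffeotopicToIdIn_range_apply_disc_eq_of_apply_zero {i i' : 𝔼 n → M}
    (hi : Manifold.IsSmoothEmbedding 𝓘(ℝ, 𝔼 n) (𝓡 n) ∞ i)
    (hi' : Manifold.IsSmoothEmbedding 𝓘(ℝ, 𝔼 n) (𝓡 n) ∞ i')
    {o₀ : Orientation ℝ (𝔼 n) (Fin (finrank ℝ (𝔼 n)))} {oM : SmoothOrientation (𝓡 n) M}
    (ho : IsOrientationPreserving (SmoothOrientation.modelSpace o₀) oM i)
    (ho' : IsOrientationPreserving (SmoothOrientation.modelSpace o₀) oM i') (h0 : i 0 = i' 0) :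
    ∃ f : M ≃ₘ⟮𝓡 n, 𝓡 n⟯ M, Diffeomorph.IsCompactlyDiffeotopicToIdIn (range i') f ∧
      ∃ ρ > (0 : ℝ), ∀ y : 𝔼 n, ‖y‖ ≤ ρ → f (i y) = i' y := by
  -- the chart `Φ' = (i')⁻¹`
  obtain ⟨Φ, hΦt, hΦs, hΦsrc, hΦc⟩ := exists_chart_of_isSmoothEmbedding hi'
  have hΦ' : ContMDiff (𝓡 n) (𝓡 n) ∞ Φ.symm := by rw [hΦs]; exact hi'.contMDiff
  have hoΦ : IsOrientationPreserving (SmoothOrientation.modelSpace o₀) oM Φ.symm := by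
    rw [hΦs]; exact ho'
  have h0src : i 0 ∈ Φ.source := by rw [h0, hΦsrc]; exact mem_range_self 0
  have hΦ0 : Φ (i 0) = 0 := by
    rw [h0, ← hΦs]; exact Φ.right_inv (by rw [hΦt]; trivial)
  -- the local map `F = Φ ∘ i`
  set V : Set (𝔼 n) := i ⁻¹' Φ.source with hV_def
  have hV : IsOpen V := Φ.open_source.preimage hi.contMDiff.continuous
  have h0V : (0 : 𝔼 n) ∈ V := h0src
  set F : (𝔼 n) → (𝔼 n) := Φ ∘ i with hF_def
  have hFs : ContMDiffOn (𝓡 n) (𝓡 n) ∞ F V :=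
    hΦc.comp hi.contMDiff.contMDiffOn fun y hy => hy
  have hFc : ContDiffOn ℝ ∞ F V := contMDiffOn_iff_contDiffOn.mp hFs
  have hF0 : F 0 = 0 := hΦ0
  have hFd : DifferentiableAt ℝ F 0 := (hFc.contDiffAt (hV.mem_nhds h0V)).differentiableAt (by simp)
  set L : (𝔼 n) →L[ℝ] (𝔼 n) := fderiv ℝ F 0 with hL_def
  -- `det L > 0`
  have hL : 0 < LinearMap.det (L : (𝔼 n) →ₗ[ℝ] (𝔼 n)) := by
    obtain ⟨hΦo, hΦd, hΦ0'⟩ := orientationAt_chart hΦc hΦ' hΦt hoΦ h0src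
    have hc := orientationAt_comp (oM := SmoothOrientation.modelSpace o₀) (oN := oM)
      (oP := SmoothOrientation.modelSpace o₀) (f := i) (g := Φ) (x := (0 : 𝔼 n))
      ((hi.contMDiff 0).mdifferentiableAt (by simp)) hΦd
      (det_mfderiv_ne_zero_of_isSmoothEmbedding hi (isOpen_range_of_isSmoothEmbedding_disc hi) 0)
      hΦ0' (ho 0) hΦo
    simp only [SmoothOrientation.modelSpace_apply, true_iff] at hc
    rwa [mfderiv_eq_fderiv] at hc
  -- straighten `L` by a compactly diffeotopic `s`
  set Le : (𝔼 n) ≃L[ℝ] (𝔼 n) := L.toContinuousLinearEquivOfDetNeZero hL.ne' with hLe_def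
  have hLe : (Le : (𝔼 n) →L[ℝ] (𝔼 n)) = L := L.coe_toContinuousLinearEquivOfDetNeZero hL.ne'
  obtain ⟨s, ρ₁, R₁, hρ₁, hs1, hs2, Ds, hDs1, hDs2⟩ :=
    isStraightenableIso_of_det_pos Le (by rw [hLe]; exact hL)
  have hs0 : s 0 = 0 := by rw [hs1 0 (by simp [hρ₁.le])]; simp
  have hs'0 : s.symm 0 = 0 := by
    have h := s.symm_apply_apply 0
    rwa [hs0] at h
  have hsL : HasFDerivAt s L 0 := by
    have hev : (s : 𝔼 n → 𝔼 n) =ᶠ[𝓝 0] Le := by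
      filter_upwards [closedBall_mem_nhds (0 : 𝔼 n) hρ₁] with y hy
      exact hs1 y (by simpa using hy)
    rw [← hLe]
    exact (Le : (𝔼 n) →L[ℝ] (𝔼 n)).hasFDerivAt.congr_of_eventuallyEq hev
  have hs'd : DifferentiableAt ℝ s.symm 0 := (s.symm.contMDiff.contDiff.differentiable (by simp)) 0
  have hinv : (fderiv ℝ s.symm 0).comp L = ContinuousLinearMap.id ℝ (𝔼 n) := by
    have h1 : HasFDerivAt (s.symm ∘ s) ((fderiv ℝ s.symm 0).comp L) 0 := by
      have h : HasFDerivAt s.symm (fderiv ℝ s.symm 0) (s 0) := by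
        rw [hs0]; exact hs'd.hasFDerivAt
      exact h.comp 0 hsL
    have h2 : (s.symm : 𝔼 n → 𝔼 n) ∘ s = id := funext fun y => s.symm_apply_apply y
    rw [h2] at h1
    exact h1.unique (hasFDerivAt_id 0)
  -- `s⁻¹ ∘ F` is tangent to the identity; straighten it by a compactly diffeotopic `G`
  set F₂ : (𝔼 n) → (𝔼 n) := s.symm ∘ F with hF₂_def
  have hF₂c : ContDiffOn ℝ ∞ F₂ V := s.symm.contMDiff.contDiff.comp_contDiffOn hFc
  have hF₂0 : F₂ 0 = 0 := by simp [hF₂_def, hF0, hs'0]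
  have hDF₂ : fderiv ℝ F₂ 0 = ContinuousLinearMap.id ℝ (𝔼 n) := by
    have h : HasFDerivAt s.symm (fderiv ℝ s.symm 0) (F 0) := by
      rw [hF0]; exact hs'd.hasFDerivAt
    have h2 : HasFDerivAt F₂ ((fderiv ℝ s.symm 0).comp L) 0 := h.comp 0 hFd.hasFDerivAt
    rw [h2.fderiv, hinv]
  obtain ⟨r, hr, hrV, G, DG, hG1, hG2, hDG1, hDG2⟩ :=
    exists_diffeomorph_diffeotopy_eq_of_fderiv_eq_id hV h0V hF₂c hF₂0 hDF₂
  have hFG : ∀ y : 𝔼 n, ‖y‖ ≤ r → F y = s (G y) := fun y hy => by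
    rw [hG1 y (by simpa using hy)]
    simp [hF₂_def]
  -- transport `T = s ∘ G` and its diffeotopy along `Φ`
  set T := G.trans s with hT_def
  have hT : ∀ y : 𝔼 n, max (2 * r) R₁ ≤ ‖y‖ → T y = y := fun y hy => by
    show s (G y) = y
    rw [hG2 y ((le_max_left _ _).trans hy), hs2 y ((le_max_right _ _).trans hy)]
  have hTD : ∃ D : Diffeotopy 𝓘(ℝ, 𝔼 n) (𝔼 n), D.stage 1 = T ∧
      ∃ R', ∀ t y, R' ≤ ‖y‖ → D.toFun t y = y := by
    refine ⟨DG.trans Ds, Diffeomorph.ext fun y => ?_, max (2 * r) R₁, fun t y hy => ?_⟩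
    · rw [Diffeotopy.coe_stage, Diffeotopy.trans_toFun, hT_def, Diffeomorph.coe_trans,
        Function.comp_apply, Function.comp_apply, ← Diffeotopy.coe_stage, ← Diffeotopy.coe_stage,
        hDG1, hDs1]
    · rw [Diffeotopy.trans_toFun, Function.comp_apply, hDG2 t y ((le_max_left _ _).trans hy),
        hDs2 t y ((le_max_right _ _).trans hy)]
  set H := chartTransportDiffeomorph hΦc hΦ' hΦt T hT with hH_def
  have hHd : Diffeomorph.IsCompactlyDiffeotopicToIdIn (range i') H :=
    isCompactlyDiffeotopicToIdIn_chartTransportDiffeomorph hΦc hΦ' hΦt T hT hTD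
      (fun x hx => by rwa [hΦsrc] at hx)
  have hHi : ∀ y : 𝔼 n, ‖y‖ ≤ r → H (i' y) = i y := fun y hy => by
    have h := chartTransportDiffeomorph_symm_apply hΦc hΦ' hΦt T hT y
    have e1 : Φ.symm y = i' y := by rw [hΦs]
    rw [e1] at h
    rw [h]
    show Φ.symm (s (G y)) = i y
    rw [← hFG y hy]
    exact Φ.left_inv (hrV (by simp; linarith [hy]))
  -- `f = H⁻¹`
  refine ⟨H.symm, hHd.symm, r, hr, fun y hy => ?_⟩
  rw [← hHi y hy, H.symm_apply_apply]

/-- **Point pushing around a loop, ending with the identity near the base point** (Hirsch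
1976, Ch. 8 §1, Thm. 1.3 and Ch. 8 §3, Thm. 3.1; the "point-pushing" diffeomorphisms of
Farb–Margalit, *Primer*, §4.2).  Let `i : ℝⁿ → M` be a disc of a Hausdorff smooth `n`-manifold
preserving the orientations `(o₀, oM)`, `U ⊇ range i` open, and `γ` a loop at the centre `i 0`
inside `U`.  Then there is a diffeotopy `D` of `M` all of whose stages are the identity off a
compact `K ⊆ U`, whose end stage is **the identity on the small disc** `i(B̄(0, ε))` (so `D₁`
fixes a neighbourhood of `i 0` pointwise), and whose track `t ↦ D_t (i 0)` is homotopic to `γ` rel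
endpoints.  Proof: push `i 0` along `γ` (`exists_diffeotopy_apply_eq_trackPath_homotopic`); the
end stage `φ` is diffeotopic to the identity, hence orientation preserving, so `φ ∘ i` and `i`
are equally oriented discs with the same centre and the local disc theorem supported in the ball
`range i` (`exists_isCompactlyDiffeotopicToIdIn_range_apply_disc_eq_of_apply_zero`) corrects `φ`
to the identity near `i 0`; the correcting track is a loop in `range i`, null-homotopic
(`Path.Homotopic.refl_of_range_subset_range_disc`). This is the level diffeotopy dragging one foot
of a `1`-handle around a loop in Laudenbach–Poénaru's handle slide `H₃`.
[cite: HirschDT1976, Ch. 8 §1, Thm. 1.3; Ch. 8 §3, Thm. 3.1] [cite: LaudenbachPoenaruBSMF1972, proof of Lemma 2 (p. 340)] -/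
theorem exists_diffeotopy_pointPush {o₀ : Orientation ℝ (𝔼 n) (Fin (finrank ℝ (𝔼 n)))}
    {oM : SmoothOrientation (𝓡 n) M} {i : 𝔼 n → M}
    (hi : Manifold.IsSmoothEmbedding 𝓘(ℝ, 𝔼 n) (𝓡 n) ∞ i)
    (ho : IsOrientationPreserving (SmoothOrientation.modelSpace o₀) oM i)
    {U : Set M} (hU : IsOpen U) (hiU : range i ⊆ U) (γ : Path (i 0) (i 0))
    (hγU : range γ ⊆ U) :
    ∃ (D : Diffeotopy (𝓡 n) M) (K : Set M), IsCompact K ∧ K ⊆ U ∧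
      (∀ t z, z ∉ K → D.toFun t z = z) ∧
      (∃ ε > (0 : ℝ), ∀ y : 𝔼 n, ‖y‖ ≤ ε → D.toFun 1 (i y) = i y) ∧
      ∃ h1 : D.toFun 1 (i 0) = i 0, ((D.trackPath (i 0)).cast rfl h1.symm).Homotopic γ := by
  -- push along `γ`
  obtain ⟨D₁, K₁, hK₁c, hK₁U, hS₁, hD₁0, hD₁1, h1, hhom⟩ :=
    exists_diffeotopy_apply_eq_trackPath_homotopic (n := n) γ hU hγU
  set φ : M ≃ₘ⟮𝓡 n, 𝓡 n⟯ M := D₁.stage 1 with hφ_def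
  have hφd : Diffeomorph.IsDiffeotopicToId φ := ⟨D₁, rfl⟩
  have hφo : φ.IsOrientationPreserving oM oM := hφd.isOrientationPreserving oM
  -- the displaced disc `φ ∘ i`
  set i₁ : 𝔼 n → M := φ ∘ i with hi₁_def
  have hi₁ : Manifold.IsSmoothEmbedding 𝓘(ℝ, 𝔼 n) (𝓡 n) ∞ i₁ := hi.diffeomorph_comp φ
  have hi₁0 : i₁ 0 = i 0 := h1
  have ho₁ : IsOrientationPreserving (SmoothOrientation.modelSpace o₀) oM i₁ :=
    IsOrientationPreserving.comp_holds hφo ho (φ.mdifferentiable (by simp))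
      (fun y => (hi.contMDiff y).mdifferentiableAt (by simp))
      (fun x => φ.det_mfderiv_ne_zero (by simp) x)
      (fun y => det_mfderiv_ne_zero_of_isSmoothEmbedding hi (isOpen_range_of_isSmoothEmbedding_disc hi) y)
  -- correct the end stage inside `range i`
  obtain ⟨f, hfd, ε, hε, hf⟩ :=
    exists_isCompactlyDiffeotopicToIdIn_range_apply_disc_eq_of_apply_zero hi₁ hi ho₁ ho hi₁0
  obtain ⟨D₂, K₂, hK₂c, hK₂i, hD₂1, hS₂⟩ := hfd
  have hD₂f : D₂.toFun 1 = f := by rw [← Diffeotopy.coe_stage, hD₂1]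
  have hf0 : f (i 0) = i 0 := by
    have h := hf 0 (by simp [hε.le])
    rwa [show i₁ 0 = i 0 from hi₁0] at h
  -- the clamped correction and the concatenation
  let D₂' : Diffeotopy (𝓡 n) M := D₂.reparam Real.smoothTransition Real.smoothTransition.contDiff
    Real.smoothTransition.zero
  have hD₂'t : ∀ t, D₂'.toFun t = D₂.toFun (Real.smoothTransition t) := fun t => rfl
  have hl₁ : ContDiff ℝ ∞ (fun t : ℝ => 2 * t) := contDiff_const.mul contDiff_id
  have hl₂ : ContDiff ℝ ∞ (fun t : ℝ => 2 * t - 1) := (contDiff_const.mul contDiff_id).sub contDiff_const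
  have hl₂0 : D₂'.toFun (2 * 0 - 1) = id := by
    rw [hD₂'t, Real.smoothTransition.zero_of_nonpos (by norm_num), D₂.toFun_zero]
  let D : Diffeotopy (𝓡 n) M :=
    (D₁.reparam (fun t => 2 * t) hl₁ (by simp)).trans (D₂'.reparam' (𝓡 n) (fun t => 2 * t - 1) hl₂ hl₂0)
  have hDt : ∀ t, D.toFun t = D₂.toFun (Real.smoothTransition (2 * t - 1)) ∘ D₁.toFun (2 * t) :=
    fun t => Diffeotopy.trans_toFun _ _ t
  have hD1 : D.toFun 1 = f ∘ φ := by
    rw [hDt, show (2 : ℝ) * 1 - 1 = 1 by norm_num, Real.smoothTransition.one, hD₂f,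
      hD₁1 _ (by norm_num)]
    rfl
  -- the loop described by `i 0` during the correction stays in `range i`
  have hloop_mem : ∀ t : ℝ, D₂.toFun t (i 0) ∈ range i := by
    intro t
    by_cases hmem : i 0 ∈ K₂
    · exact hK₂i (D₂.toFun_mem_of_forall_eq_self (hS₂ t) hmem)
    · rw [hS₂ t _ hmem]; exact mem_range_self 0
  have h2 : D₂'.toFun 1 (i 0) = i 0 := by
    rw [hD₂'t, Real.smoothTransition.one, hD₂f, hf0]
  set P₂ : Path (i 0) (i 0) := (D₂'.trackPath (i 0)).cast rfl h2.symm with hP₂_def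
  have hP₂ : P₂.Homotopic (Path.refl (i 0)) := by
    refine Path.Homotopic.refl_of_range_subset_range_disc hi P₂ ?_
    rintro _ ⟨t, rfl⟩
    exact hloop_mem _
  set P₁ : Path (i 0) (i 0) := (D₁.trackPath (i 0)).cast rfl h1.symm with hP₁_def
  have h1' : D.toFun 1 (i 0) = i 0 := by
    rw [hD1, comp_apply, show φ (i 0) = i 0 from h1, hf0]
  -- the track of the concatenation is the concatenation of the tracks
  have htrack : (D.trackPath (i 0)).cast rfl h1'.symm = P₁.trans P₂ := by
    ext t
    rw [Path.cast_coe, Diffeotopy.trackPath_apply, hDt, comp_apply, Path.trans_apply]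
    split_ifs with ht
    · rw [Real.smoothTransition.zero_of_nonpos (by linarith), D₂.toFun_zero, id, hP₁_def,
        Path.cast_coe, Diffeotopy.trackPath_apply]
    · rw [not_le] at ht
      rw [hD₁1 _ (by linarith), h1, hP₂_def, Path.cast_coe, Diffeotopy.trackPath_apply, hD₂'t]
  refine ⟨D, K₁ ∪ K₂, hK₁c.union hK₂c, union_subset hK₁U (hK₂i.trans hiU), fun t z hz => ?_,
    ⟨ε, hε, fun y hy => ?_⟩, h1', ?_⟩
  · rw [hDt, comp_apply, hS₁ _ z (fun h => hz (Or.inl h)), hS₂ _ z (fun h => hz (Or.inr h))]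
  · rw [hD1, comp_apply]
    exact hf y hy
  · rw [htrack]
    exact (hhom.hcomp hP₂).trans ⟨Path.Homotopy.transRefl γ⟩

end Loop

end Literature.Topology.FourManifolds
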